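import Summits.Ventures.PercRepro.Conjectures
import Summits.Ventures.PercRepro.C005
import Summits.Ventures.PercRepro.SMCPrinciple
import Summits.Ventures.PercRepro.Antipodal

/-!
# Lemma B: the sub-cube (antipodal) criterion for C-005

**Lemma B** (lead, INBOX 2026-08-22T02:25Z; p4 Theorem A, p1 §2, p3 `proofs/P3-C005-classwise.md`):
for a finite multigraph with marked vertices `a, b, c, d`, every edge set `S` and every state
`ω₀` of the other edges, among the `2^|S|` ways of 2-colouring `S` (red `σ`, blue `σ̄`, the
others as in `ω₀`)
  `#{red ∈ top, blue ∈ bot} + #{red ∈ bot, blue ∈ top} ≥ #{(red, blue) ∈ xᵢ × xⱼ, i ≠ j}`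
(`top = {a~b~c~d}`, `bot = {a|b|c|d}`, `x₁, x₂, x₃` the three crossing two-block cells). This
file states it as the named Prop `LemmaB` (per graph: `MultiGraph.LemmaB`) — the antipodal sum
of the **C-005 kernel** `c005Kernel ω ω' = 1_top(ω)1_bot(ω') + 1_bot(ω)1_top(ω') - ∑_{i≠j} 1_{xᵢ}(ω)1_{xⱼ}(ω')`
is nonnegative on every sub-cube — and proves the REDUCTION: Lemma B implies C-005 for all
weight vectors (`pairSum_of_lemmaB`, `C005conn_of_LemmaB`, `C005_of_LemmaB`), through p4's
`antipodal_principle` and the identity `dsum w_p w_p c005Kernel = 2·(top·bot − e₂(x))`.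
Also: `C005_iff_C005conn` (typer-2's engine-row form ↔ the event form) and the counting form
`antipodalSum_c005Kernel` of the sub-cube sum.
-/

namespace PercRepro

open Finset

namespace MultiGraph

variable {V E : Type*} [Fintype E] [DecidableEq E] (G : MultiGraph V E)

/-- The **C-005 kernel** on pairs of configurations:
`1_top(ω) 1_bot(ω') + 1_bot(ω) 1_top(ω') - ∑_{i ≠ j} 1_{xᵢ}(ω) 1_{xⱼ}(ω')`. -/
noncomputable def c005Kernel (a b c d : V) (ω ω' : Config E) : ℝ :=
  (G.topEvent a b c d).indicator 1 ω * (G.botEvent a b c d).indicator 1 ω' +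
    (G.botEvent a b c d).indicator 1 ω * (G.topEvent a b c d).indicator 1 ω' -
    ((G.crossEvent₁ a b c d).indicator 1 ω * (G.crossEvent₂ a b c d).indicator 1 ω' +
      (G.crossEvent₂ a b c d).indicator 1 ω * (G.crossEvent₁ a b c d).indicator 1 ω' +
      (G.crossEvent₁ a b c d).indicator 1 ω * (G.crossEvent₃ a b c d).indicator 1 ω' +
      (G.crossEvent₃ a b c d).indicator 1 ω * (G.crossEvent₁ a b c d).indicator 1 ω' +
      (G.crossEvent₂ a b c d).indicator 1 ω * (G.crossEvent₃ a b c d).indicator 1 ω' +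
      (G.crossEvent₃ a b c d).indicator 1 ω * (G.crossEvent₂ a b c d).indicator 1 ω')

/-- **Lemma B for one graph and marking**: over every sub-cube of edge states (edges of `S`
free, the others fixed by `ω₀`) the C-005 kernel summed over antipodal pairs is nonnegative. -/
def LemmaB (a b c d : V) : Prop :=
  ∀ (S : Finset E) (ω₀ : Config E),
    0 ≤ ∑ σ : Config E, G.c005Kernel a b c d (patch S σ ω₀) (patch S (flipOn S σ) ω₀)

/-- The double sum of a product of indicators is the product of the probabilities. -/
theorem dsum_indicator_mul (p : E → ℝ) (A B : Set (Config E)) :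
    dsum (weight p) (weight p) (fun ω ω' => A.indicator 1 ω * B.indicator 1 ω') =
      prob p A * prob p B := by
  rw [prob_eq_expect_indicator, prob_eq_expect_indicator]
  unfold dsum expect
  rw [Finset.sum_mul_sum]
  refine Finset.sum_congr rfl fun ω _ => Finset.sum_congr rfl fun ω' _ => ?_
  ring

omit [Fintype E] [DecidableEq E] in
/-- The kernel as an explicit combination of product kernels (pointwise). -/
theorem c005Kernel_apply (a b c d : V) (ω ω' : Config E) :
    G.c005Kernel a b c d ω ω' =
      (G.topEvent a b c d).indicator 1 ω * (G.botEvent a b c d).indicator 1 ω' +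
        (G.botEvent a b c d).indicator 1 ω * (G.topEvent a b c d).indicator 1 ω' -
        (G.crossEvent₁ a b c d).indicator 1 ω * (G.crossEvent₂ a b c d).indicator 1 ω' -
        (G.crossEvent₂ a b c d).indicator 1 ω * (G.crossEvent₁ a b c d).indicator 1 ω' -
        (G.crossEvent₁ a b c d).indicator 1 ω * (G.crossEvent₃ a b c d).indicator 1 ω' -
        (G.crossEvent₃ a b c d).indicator 1 ω * (G.crossEvent₁ a b c d).indicator 1 ω' -
        (G.crossEvent₂ a b c d).indicator 1 ω * (G.crossEvent₃ a b c d).indicator 1 ω' -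
        (G.crossEvent₃ a b c d).indicator 1 ω * (G.crossEvent₂ a b c d).indicator 1 ω' := by
  unfold c005Kernel
  ring

/-- **The quadratic form of the C-005 kernel**: `dsum w_p w_p c005Kernel = 2·(top·bot − e₂(x))`. -/
theorem dsum_c005Kernel (p : E → ℝ) (a b c d : V) :
    dsum (weight p) (weight p) (G.c005Kernel a b c d) =
      2 * (prob p (G.topEvent a b c d) * prob p (G.botEvent a b c d) -
        (prob p (G.crossEvent₁ a b c d) * prob p (G.crossEvent₂ a b c d) +
          prob p (G.crossEvent₁ a b c d) * prob p (G.crossEvent₃ a b c d) +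
          prob p (G.crossEvent₂ a b c d) * prob p (G.crossEvent₃ a b c d))) := by
  have key : ∀ A B : Set (Config E), ∑ ω, ∑ ω', weight p ω * weight p ω' *
      (A.indicator 1 ω * B.indicator 1 ω') = prob p A * prob p B := fun A B =>
    dsum_indicator_mul p A B
  unfold dsum
  simp only [c005Kernel_apply, mul_add, mul_sub, Finset.sum_add_distrib, Finset.sum_sub_distrib, key]
  ring

/-- **Reduction (one graph)**: Lemma B for `(G, a, b, c, d)` gives C-005 for that graph and
marking at every weight vector. -/
theorem pairSum_of_lemmaB {p : E → ℝ} (hp : IsProb p) {a b c d : V} (h : G.LemmaB a b c d) :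
    prob p (G.crossEvent₁ a b c d) * prob p (G.crossEvent₂ a b c d) +
        prob p (G.crossEvent₁ a b c d) * prob p (G.crossEvent₃ a b c d) +
        prob p (G.crossEvent₂ a b c d) * prob p (G.crossEvent₃ a b c d) ≤
      prob p (G.topEvent a b c d) * prob p (G.botEvent a b c d) := by
  have h1 := antipodal_principle (G.c005Kernel a b c d) (h) hp
  rw [G.dsum_c005Kernel] at h1
  linarith

open scoped Classical in
omit [Fintype E] [DecidableEq E] in
/-- The product of two indicators is the indicator of the pair condition. -/
theorem indicator_mul_indicator (A B : Set (Config E)) (ω ω' : Config E) :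
    A.indicator (1 : Config E → ℝ) ω * B.indicator 1 ω' = if ω ∈ A ∧ ω' ∈ B then 1 else 0 := by
  by_cases hA : ω ∈ A <;> by_cases hB : ω' ∈ B <;> simp [Set.indicator, hA, hB]

open scoped Classical in
/-- The sub-cube sum in **counting form**: `#{(top, bot)} + #{(bot, top)} − ∑_{i ≠ j} #{(xᵢ, xⱼ)}`
(each antipodal class of the sub-cube counted `2^{|E ∖ S|}` times, as in `antipodal_principle`). -/
theorem antipodalSum_c005Kernel (a b c d : V) (S : Finset E) (ω₀ : Config E) :
    ∑ σ : Config E, G.c005Kernel a b c d (patch S σ ω₀) (patch S (flipOn S σ) ω₀) =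
      ((univ.filter fun σ : Config E => patch S σ ω₀ ∈ G.topEvent a b c d ∧
          patch S (flipOn S σ) ω₀ ∈ G.botEvent a b c d).card : ℝ) +
        ((univ.filter fun σ : Config E => patch S σ ω₀ ∈ G.botEvent a b c d ∧
          patch S (flipOn S σ) ω₀ ∈ G.topEvent a b c d).card : ℝ) -
        (((univ.filter fun σ : Config E => patch S σ ω₀ ∈ G.crossEvent₁ a b c d ∧
            patch S (flipOn S σ) ω₀ ∈ G.crossEvent₂ a b c d).card : ℝ) +
          ((univ.filter fun σ : Config E => patch S σ ω₀ ∈ G.crossEvent₂ a b c d ∧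
            patch S (flipOn S σ) ω₀ ∈ G.crossEvent₁ a b c d).card : ℝ) +
          ((univ.filter fun σ : Config E => patch S σ ω₀ ∈ G.crossEvent₁ a b c d ∧
            patch S (flipOn S σ) ω₀ ∈ G.crossEvent₃ a b c d).card : ℝ) +
          ((univ.filter fun σ : Config E => patch S σ ω₀ ∈ G.crossEvent₃ a b c d ∧
            patch S (flipOn S σ) ω₀ ∈ G.crossEvent₁ a b c d).card : ℝ) +
          ((univ.filter fun σ : Config E => patch S σ ω₀ ∈ G.crossEvent₂ a b c d ∧
            patch S (flipOn S σ) ω₀ ∈ G.crossEvent₃ a b c d).card : ℝ) +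
          ((univ.filter fun σ : Config E => patch S σ ω₀ ∈ G.crossEvent₃ a b c d ∧
            patch S (flipOn S σ) ω₀ ∈ G.crossEvent₂ a b c d).card : ℝ)) := by
  simp only [Finset.card_filter]
  push_cast
  simp only [← Finset.sum_add_distrib, ← Finset.sum_sub_distrib]
  refine Finset.sum_congr rfl fun σ _ => ?_
  rw [c005Kernel_apply]
  simp only [indicator_mul_indicator]
  ring

end MultiGraph

/-- **Lemma B** (all graphs, all markings): the C-005 kernel summed over the antipodal pairs of
every sub-cube of every finite multigraph is nonnegative. The open combinatorial core of C-005. -/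
def LemmaB : Prop :=
  ∀ {V E : Type} [Fintype E] [DecidableEq E] (G : MultiGraph V E) (a b c d : V),
    G.LemmaB a b c d

/-- **Theorem A / reduction**: Lemma B implies C-005 in event form. -/
theorem C005conn_of_LemmaB (h : LemmaB) : C005conn :=
  fun G _ hp a b c d => G.pairSum_of_lemmaB hp (h G a b c d)

/-- The engine-row form `C005` (typer-2) and the event form `C005conn` are the same statement. -/
theorem C005_iff_C005conn : C005 ↔ C005conn := by
  constructor
  · intro h V E _ _ G p hp a b c d
    have := h G p hp a b c d
    rwa [G.partitionEvent_row4_top, G.partitionEvent_row4_bot, G.partitionEvent_row4_cross₁,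
      G.partitionEvent_row4_cross₂, G.partitionEvent_row4_cross₃] at this
  · intro h V E _ _ G p hp a b c d
    rw [G.partitionEvent_row4_top, G.partitionEvent_row4_bot, G.partitionEvent_row4_cross₁,
      G.partitionEvent_row4_cross₂, G.partitionEvent_row4_cross₃]
    exact h G p hp a b c d

/-- Lemma B implies C-005 in engine-row form. -/
theorem C005_of_LemmaB (h : LemmaB) : C005 :=
  C005_iff_C005conn.2 (C005conn_of_LemmaB h)

end PercRepro
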